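import Summits.NavierStokesRegularity.NavierStokesRegularity.Theorems.PalasekTowerBreakdownEpisodeBaseTAgmonBoundExplicit
import Summits.NavierStokesRegularity.NavierStokesRegularity.Theses.PalasekTowerBreakdown
import Summits.NavierStokesRegularity.FluidComputer.PalasekTowerStrainDoorAtHybridParam

/-!
# `EpisodeBaseT` (crux stmt-NavierStokesRegularity-20303) from ONE HYBRID-CURRENCY STRAIN CERTIFICATE WITH THE EXPLICIT
# AGMON CONSTANT `A = 4502/10000` — BY NAME, every field a closed-form real inequality

Cell `ns-blowup`, seat `ns-blowup-fc-prover-2` (g10). Route `PalasekTowerBreakdown` (rev 19: `EpisodeBaseT := EpisodeBaseGAt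
TowerRates.tuned`). The `AgmonBoundR3` re-thread of the robustness vein (Literature `NSRobustnessOfRegularityAgmonParam*`, this
seat) makes the hybrid certificate letter parametric in the Agmon constant (`StrainDoor.CertificateDataHybridOf A`); the
explicit contract `AgmonExplicitSobolev.agmonBoundR3_of_ge` (`√2/π ≤ A ⇒ AgmonBoundR3 A`) with `√2/π < 4502/10000`
(`AgmonExplicitSobolev.sqrt_two_div_pi_lt`) discharges it at the NUMERAL `A = 4502/10000`; the mechanism door at `tuned` is
paid (`Germ.mechanismDoorAt_of_boxNumerics TowerRates.tuned_boxNumerics`). LABEL: E–C typing (KERNEL: theorem only;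
`--supports` stmt-NavierStokesRegularity-20303). WHAT THIS IS NOT: not Navier–Stokes evidence — no certificate is exhibited;
`EpisodeBaseT` appears only as the conclusion of a conditional; nothing about `RungG 1` or blow-up is asserted.

* `palasekTowerBreakdown_episodeBaseT_of_certificateDataHybridOf_explicit` — ONE
  `StrainDoor.CertificateDataHybridOf (4502/10000) TowerRates.tuned …` ⟹ `EpisodeBaseT`.

References: S. Palasek, arXiv:2605.13827 §4 [cite: Palasek2026ElementaryModel, §4]; T. Tao, Anal. PDE 6 (2013) Thm. 5.4
[cite: Tao2011, Thm. 5.4 (ii)+(iv)]; RRS 2016 Thm 1.20 [cite: RobinsonRodrigoSadowskiCUP2016, Thm 1.20].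
-/

noncomputable section

-- `Summit.<Summit>.<Problem>` is the tree's mandated summit-side namespace (CONVENTIONS §2); for this
-- single-conjunct summit the two coincide, so the duplicate is deliberate.
set_option linter.dupNamespace false

namespace Summit.NavierStokesRegularity.NavierStokesRegularity.Theorems

open Summit.NavierStokesRegularity.NavierStokesRegularity.Theses
open Summit.NavierStokesRegularity.FluidComputer.PalasekTowerClayBridge

/-- **`EpisodeBaseT` FROM ONE HYBRID-CURRENCY STRAIN CERTIFICATE WITH AGMON CONSTANT `4502/10000`** (the Agmon contract is
`AgmonExplicitSobolev.agmonBoundR3_of_ge sqrt_two_div_pi_lt.le`; the mechanism door at `tuned` is paid).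
[cite: Palasek2026ElementaryModel, §4] [cite: RobinsonRodrigoSadowskiCUP2016, Thm 1.20] -/
theorem palasekTowerBreakdown_episodeBaseT_of_certificateDataHybridOf_explicit
    {U : EuclideanSpace ℝ (Fin 3) → EuclideanSpace ℝ (Fin 3)} {ρ : ℝ}
    {w r : ℝ → EuclideanSpace ℝ (Fin 3) → EuclideanSpace ℝ (Fin 3)} {ϖ : ℝ → EuclideanSpace ℝ (Fin 3) → ℝ}
    {G σ₂ σ₃ Rr L H₁ ψ₁ ψ₂ X₁ Dτ Ψτ : ℝ → ℝ} {Bw E₀ κ μ D₁ Ψ₁ D₂ Ψ₂ δ η τw : ℝ}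
    (c : StrainDoor.CertificateDataHybridOf (4502 / 10000) TowerRates.tuned U ρ w r ϖ G σ₂ σ₃ Rr L H₁ ψ₁ ψ₂ X₁ Dτ Ψτ
      Bw E₀ κ μ D₁ Ψ₁ D₂ Ψ₂ δ η τw) :
    PalasekTowerBreakdown.EpisodeBaseT := by
  unfold PalasekTowerBreakdown.EpisodeBaseT
  exact StrainDoor.episodeBaseGAt_tuned_of_certificateDataHybridOf
    (AgmonExplicitSobolev.agmonBoundR3_of_ge AgmonExplicitSobolev.sqrt_two_div_pi_lt.le) c

end Summit.NavierStokesRegularity.NavierStokesRegularity.Theorems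

end
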